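import Summits.CriticalPhenomena.CardyFormulaZ2.Theorems.CardyTensorRGPolyominoGaussianLawStubDilationEquicontinuityPart4
import Literature.Probability.Percolation.CardyFormula
import Literature.Probability.Percolation.BoxCrossingJordan
import Literature.Probability.Percolation.QuadCrossingContinuityUniform
import Literature.Probability.Percolation.QuadCrossingContinuityOfLemma51
import Literature.Probability.Percolation.QuadCrossingContinuityEventsDischarge

/-!
# Stub `stub_dilationEquicontinuity` of the birth skeleton of the crux `PolyominoGaussianLaw`
# (stmt-CriticalPhenomena-14337, route `CardyTensorRG`, line `registered`, skeleton v2)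

**Statement (registered stub, proved here verbatim).** For a polyomino conformal rectangle `R`
(carrier = interior of a finite union of closed `δ₀`-squares, marks at `δ₀`-lattice points) and
`ε > 0` there are `ρ > 1` and `δ₁ > 0` such that every conformal rectangle `R'` with carrier `t · Ω`
and arcs `0`, `2` equal to `t · (ab)`, `t · (cd)`, `t ∈ [1/ρ, 1]`, has, at every mesh
`0 < δ < δ₁`, a bond-`ℤ²` crossing probability `bondDomainCrossingProb R' δ` within `ε` of
`bondDomainCrossingProb R δ`.

**Proof (Schramm–Smirnov sandwich).** Read `R` through a square model `Φ` (Schoenflies,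
`exists_isSquareModel`): carrier `Φ((-1,1)²)`, `(ab) = Φ`(bottom), `(cd) = Φ`(top), and let
`Q = squareModelQuad Φ ∈ 𝒬_ℂ` be its parametrised quad. Schramm–Smirnov's discrete continuity
estimate (5.1) for critical bond percolation on `δℤ²` is a THEOREM of the tree
(`Quad.continuity_of_lemma_5_1` applied to the discharged `SchrammSmirnov2011_lemma_5_1_holds`),
and its uniform form `Quad.continuity_uniform_pair` on the compact family `{Q}` gives `δ_c, r > 0`
with `P_{1/2}[P' crossed ∧ P'' not crossed] ≤ ε` for ALL parametrised quads `P', P''` within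
uniform distance `r` of `Q` and all meshes `δ < δ_c`. Parts 3–4 sandwich, for every dilation
factor `t ∈ [1/ρ, 1] ⊆ [1/2, 1]` and every mesh `δ < δ₁`, the discrete crossing event of `t · R`
at mesh `δ` between the crossing events of the narrower quad `Q⁺_t` and of the shorter quad `Q⁻_t`
of the frame `t Φ` (`dl_sandwich_at` below, uniform in `t`: the modulus of `Φ⁻¹` transported to the
frame `t Φ`, the bond property of the polyomino `t Ω` of side `t δ₀ > δ` (Part 1), and the bulk
property of H21's discretisation of the ORIGINAL rectangle (`forall_mem_meshDomain_of_isCompact`)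
transported by the exact scaling `meshDomain (t Ω) δ = meshDomain Ω (δ / t)` (Part 3)), all four
quads `Q±_t`, `Q±_1` being within `r` of `Q` (Part 2: `ρ - 1` is chosen below `r / (4 (M + 1))`,
`M` a bound of `Φ` on the square, and the shrink `w` below the `r/4`-modulus of `Φ`). Hence
`P(t·R) - P(R) ≤ μ(Q⁻_t crossed) - μ(Q⁺_1 crossed) ≤ μ(Q⁻_t crossed ∧ Q⁺_1 not) ≤ ε` and
symmetrically. No percolation estimate is re-proved here: RSW enters only through the tree's
Lemma 5.1.

References: O. Schramm, S. Smirnov, *On the scaling limits of planar percolation*, Ann. Probab. 39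
(2011), §1.3, Lemma 5.1, eq. (5.1), Lemma 6.1 [SchrammSmirnov2011]; G. Grimmett, *Probability on
Graphs* (2018), §5.7 (RSW non-degeneracy of conformal-rectangle crossings) [Grimmett2018].
-/

noncomputable section

open Set Metric Complex Filter MeasureTheory
open scoped unitInterval ENNReal
open Literature.Probability.LatticeModels Literature.Probability.Percolation
open Literature.Probability.Percolation.QuadCrossing Literature.Probability.RandomPlanarGeometry

namespace Summit.CriticalPhenomena.CardyFormulaZ2.Cruxes.PolyominoGaussianLaw.Birth

/-- **The sandwich at a dilate, uniformly in the dilation factor.** See the module docstring.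
[folklore] -/
theorem dl_sandwich_at (Φ sa sb : ℂ ≃ₜ ℂ) {s : Finset (ℤ × ℤ)} {δ₀ w η δb t δ : ℝ}
    (hΩ : Φ '' (Ioo (-1 : ℝ) 1 ×ℂ Ioo (-1 : ℝ) 1) =
      interior (⋃ p ∈ s, {z : ℂ | δ₀ * (p.1 : ℝ) ≤ z.re ∧ z.re ≤ δ₀ * ((p.1 : ℝ) + 1) ∧
        δ₀ * (p.2 : ℝ) ≤ z.im ∧ z.im ≤ δ₀ * ((p.2 : ℝ) + 1)}))
    (hw0 : 0 < w) (hw1 : w ≤ 1 / 2)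
    (hsa : ∀ z : ℂ, sa z = ⟨1 * z.re, (1 - w) * z.im⟩)
    (hsb : ∀ z : ℂ, sb z = ⟨(1 - w) * z.re, 1 * z.im⟩)
    (hη : ∀ z ∈ Φ '' (Icc (-1 : ℝ) 1 ×ℂ Icc (-1 : ℝ) 1), ∀ z' ∈ Φ '' (Icc (-1 : ℝ) 1 ×ℂ Icc (-1 : ℝ) 1),
      dist z z' < η → dist (Φ.symm z) (Φ.symm z') < w / 4)
    (hbulk : ∀ δ' : ℝ, 0 < δ' → δ' < δb → ∀ x : Site 2,
      meshPoint δ' x ∈ Φ '' (Icc (-((1 + (1 - w)) / 2)) ((1 + (1 - w)) / 2) ×ℂ Icc (-(1 / 2 : ℝ)) (1 / 2)) →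
      x ∈ meshDomain (Φ '' (Ioo (-1 : ℝ) 1 ×ℂ Ioo (-1 : ℝ) 1)) δ')
    (ht12 : 1 / 2 ≤ t) (hδ : 0 < δ) (hδη : 16 * δ < η) (hδδ₀ : 2 * δ < δ₀)
    (hδb : 2 * δ < δb) (ht' : (t : ℂ) ≠ 0) :
    ({ω | ∃ K, (squareModelQuad (sb.trans (Φ.trans (Homeomorph.mulLeft₀ (t : ℂ) ht')))).IsCrossing K ∧
        K ⊆ openEdgeUnion δ ω} ⊆
      discreteCrossing ((fun z : ℂ => (t : ℂ) * z) '' (Φ '' (Ioo (-1 : ℝ) 1 ×ℂ Ioo (-1 : ℝ) 1))) δ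
        ((fun z : ℂ => (t : ℂ) * z) '' (Φ '' {p : ℂ | p.im = -1 ∧ p.re ∈ Icc (-1 : ℝ) 1}))
        ((fun z : ℂ => (t : ℂ) * z) '' (Φ '' {p : ℂ | p.im = 1 ∧ p.re ∈ Icc (-1 : ℝ) 1}))) ∧
    (discreteCrossing ((fun z : ℂ => (t : ℂ) * z) '' (Φ '' (Ioo (-1 : ℝ) 1 ×ℂ Ioo (-1 : ℝ) 1))) δ
        ((fun z : ℂ => (t : ℂ) * z) '' (Φ '' {p : ℂ | p.im = -1 ∧ p.re ∈ Icc (-1 : ℝ) 1}))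
        ((fun z : ℂ => (t : ℂ) * z) '' (Φ '' {p : ℂ | p.im = 1 ∧ p.re ∈ Icc (-1 : ℝ) 1})) ⊆
      {ω | ∃ K, (squareModelQuad (sa.trans (Φ.trans (Homeomorph.mulLeft₀ (t : ℂ) ht')))).IsCrossing K ∧
        K ⊆ openEdgeUnion δ ω}) := by
  set Mt : ℂ ≃ₜ ℂ := Homeomorph.mulLeft₀ (t : ℂ) ht' with hMt
  set Ψ : ℂ ≃ₜ ℂ := Φ.trans Mt with hΨ
  have ht0 : 0 < t := by linarith
  have hΨimg : ∀ S : Set ℂ, Ψ '' S = (fun z : ℂ => (t : ℂ) * z) '' (Φ '' S) := fun S => by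
    rw [hΨ, show (⇑(Φ.trans Mt) : ℂ → ℂ) = Mt ∘ Φ from rfl, image_comp, hMt, Homeomorph.coe_mulLeft₀]
  rw [← hΨimg, ← hΨimg, ← hΨimg]
  -- the modulus hypothesis for `Ψ`
  have hΨS : ∀ z ∈ Ψ '' (Icc (-1 : ℝ) 1 ×ℂ Icc (-1 : ℝ) 1),
      (t : ℂ)⁻¹ * z ∈ Φ '' (Icc (-1 : ℝ) 1 ×ℂ Icc (-1 : ℝ) 1) ∧ Ψ.symm z = Φ.symm ((t : ℂ)⁻¹ * z) := by
    intro z hz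
    rw [hΨimg] at hz
    obtain ⟨y, hy, rfl⟩ := hz
    refine ⟨by rw [← mul_assoc, inv_mul_cancel₀ ht', one_mul]; exact hy, ?_⟩
    rw [hΨ, Homeomorph.symm_trans_apply, hMt, Homeomorph.mulLeft₀_symm_apply]
  have hηΨ : ∀ c : ℝ, c ≤ 8 → ∀ z ∈ Ψ '' (Icc (-1 : ℝ) 1 ×ℂ Icc (-1 : ℝ) 1),
      ∀ z' ∈ Ψ '' (Icc (-1 : ℝ) 1 ×ℂ Icc (-1 : ℝ) 1), dist z z' < c * δ →
      dist (Ψ.symm z) (Ψ.symm z') < w / 4 := by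
    intro c hc z hz z' hz' hd
    obtain ⟨h1, e1⟩ := hΨS z hz
    obtain ⟨h2, e2⟩ := hΨS z' hz'
    rw [e1, e2]
    apply hη _ h1 _ h2
    have hti : t⁻¹ ≤ 2 := by
      rw [inv_le_comm₀ ht0 (by norm_num)]; linarith
    rw [dist_eq_norm, ← mul_sub, norm_mul, norm_inv, Complex.norm_real, Real.norm_eq_abs,
      abs_of_pos ht0, ← dist_eq_norm]
    calc t⁻¹ * dist z z' ≤ 2 * dist z z' := mul_le_mul_of_nonneg_right hti dist_nonneg
      _ < 2 * (c * δ) := by linarith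
      _ ≤ 2 * (8 * δ) := by nlinarith [hδ.le]
      _ < η := by linarith
  -- the polyomino of the dilate and its bond property
  have hΩt : ∀ z, z ∈ Ψ '' (Ioo (-1 : ℝ) 1 ×ℂ Ioo (-1 : ℝ) 1) ↔
      z - ((t * δ₀ / 2 : ℝ) : ℂ) * (1 + Complex.I) ∈
        meshPolygon {x : Site 2 | (x 0, x 1) ∈ s} (t * δ₀) := fun z => by
    rw [hΨimg, hΩ, dl_image_mul_cornerPolyomino ht0 s]
    exact dl_mem_cornerPolyomino_iff (t * δ₀) s z
  have hD2 : ∀ x y : Site 2, (zdGraph 2).Adj x y →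
      meshPoint δ x ∈ Ψ '' (Ioo (-1 : ℝ) 1 ×ℂ Ioo (-1 : ℝ) 1) →
      meshPoint δ y ∈ Ψ '' (Ioo (-1 : ℝ) 1 ×ℂ Ioo (-1 : ℝ) 1) →
      segment ℝ (meshPoint δ x) (meshPoint δ y) ⊆ Ψ '' (Ioo (-1 : ℝ) 1 ×ℂ Ioo (-1 : ℝ) 1) :=
    fun x y hxy hx hy =>
      dl_segment_subset_of_adj (a := t * δ₀) (mul_pos ht0 (by linarith)) hδ (by nlinarith) _ hΩt hxy hx hy
  -- the bulk property of the dilate, from that of the original rectangle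
  have hbulkΨ : ∀ x : Site 2, meshPoint δ x ∈
      Ψ '' (Icc (-((1 + (1 - w)) / 2)) ((1 + (1 - w)) / 2) ×ℂ Icc (-(1 / 2 : ℝ)) (1 / 2)) →
      x ∈ meshDomain (Ψ '' (Ioo (-1 : ℝ) 1 ×ℂ Ioo (-1 : ℝ) 1)) δ := by
    intro x hx
    rw [hΨimg, dl_meshDomain_image_mul ht0]
    rw [hΨimg] at hx
    obtain ⟨k, hk, hkx⟩ := hx
    refine hbulk (δ / t) (div_pos hδ ht0) ?_ x ?_
    · rw [div_lt_iff₀ ht0]; nlinarith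
    · rw [dl_meshPoint_div, ← hkx, ← mul_assoc, inv_mul_cancel₀ ht', one_mul]
      exact hk
  constructor
  · exact dl_cross_subset_discreteCrossing Ψ sb (by linarith) (by linarith) hsb hδ
      (fun z hz z' hz' hd => by rw [sub_sub_cancel]; exact hηΨ 8 le_rfl z hz z' hz' hd) hD2 hbulkΨ
  · refine dl_discreteCrossing_subset_cross Ψ sa (by linarith) hsa hδ (fun z hz z' hz' hd => ?_)
    have := hηΨ 2 (by norm_num) z hz z' hz' hd
    rw [sub_sub_cancel]
    linarith

/-- **The comparison quads of the dilate are uniformly close to the quad of the rectangle.**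
For `t ∈ [1/2, 1]` with `(1 - t) M ≤ r / 4` and `w` below the `r/4`-modulus of `Φ`, both quads
`squareModelQuad (s? ∘ t Φ)` are within `r/2 < r` of `squareModelQuad Φ` (Part 2). [folklore] -/
theorem dl_dist_quads_lt (Φ sc : ℂ ≃ₜ ℂ) {α β t r M η' : ℝ}
    (hsc : ∀ z : ℂ, sc z = ⟨α * z.re, β * z.im⟩) (hα : 0 < α) (hα1 : α ≤ 1) (hβ : 0 < β) (hβ1 : β ≤ 1)
    (hr : 0 < r) (ht1 : t ≤ 1)
    (hM : ∀ z ∈ Icc (-1 : ℝ) 1 ×ℂ Icc (-1 : ℝ) 1, ‖Φ z‖ ≤ M) (htM : (1 - t) * M ≤ r / 4)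
    (hη' : ∀ z ∈ Icc (-1 : ℝ) 1 ×ℂ Icc (-1 : ℝ) 1, ∀ z' ∈ Icc (-1 : ℝ) 1 ×ℂ Icc (-1 : ℝ) 1,
      dist z z' < η' → dist (Φ z) (Φ z') < r / 4)
    (hw : |α - 1| + |β - 1| < η') (ht' : (t : ℂ) ≠ 0) :
    dist (squareModelQuad (sc.trans (Φ.trans (Homeomorph.mulLeft₀ (t : ℂ) ht'))))
      (squareModelQuad Φ) < r :=
  (dl_dist_squareModelQuad_le Φ sc hsc hα hα1 hβ hβ1 hr.le ht1 hM htM hη' hw ht').trans_lt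
    (by linarith)


/-- Outer-measure bookkeeping of the sandwich: if `A ⊆ B`, `C ⊆ D` and `μ(B ∖ C) ≤ ε` then
`μ(A) - μ(D) ≤ ε` (real masses of a finite measure; no measurability needed). [folklore] -/
theorem dl_real_sub_le {Ω : Type*} [MeasurableSpace Ω] (μ : Measure Ω) [IsFiniteMeasure μ]
    {A B C D : Set Ω} (hAB : A ⊆ B) (hCD : C ⊆ D) {ε : ℝ} (h : μ.real (B \ C) ≤ ε) :
    μ.real A - μ.real D ≤ ε := by
  have h1 : μ.real A ≤ μ.real B := measureReal_mono hAB
  have h2 : μ.real C ≤ μ.real D := measureReal_mono hCD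
  have h3 : μ.real B ≤ μ.real C + μ.real (B \ C) :=
    (measureReal_mono (s₂ := C ∪ (B \ C)) (fun x hx => by
      by_cases hxC : x ∈ C
      · exact Or.inl hxC
      · exact Or.inr ⟨hx, hxC⟩)).trans (measureReal_union_le C (B \ C))
  linarith

/-- stub 5 (RSW dilation-equicontinuity at fixed mesh; the Schramm–Smirnov-type residue). For a
polyomino conformal rectangle `R` with lattice marks and `ε > 0` there are `ρ > 1`, `δ₁ > 0` such that
every dilate `R'` of `R` by a factor `t ∈ [1/ρ, 1]` (carrier `t·Ω`, arcs `t·(ab)`, `t·(cd)`) has, at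
every mesh `0 < δ < δ₁`, a bond-ℤ² crossing probability within `ε` of that of `R` at the same mesh.
Proof: Schramm–Smirnov's continuity (5.1) of quad-crossing events for bond-`ℤ²`
(`Quad.continuity_uniform_pair` + `SchrammSmirnov2011_lemma_5_1_holds`) and the deterministic
sandwich of Parts 1–4 between H21's discrete-arc crossing events and the crossing events of the
perturbed quads of a square model of `R` (Schramm–Smirnov 2011, §1.3, Lemma 5.1, eq. (5.1)). [folklore] -/
theorem stub_dilationEquicontinuity :
    ∀ R : Literature.Probability.RandomPlanarGeometry.ConformalRectangle,
      (∃ δ₀ : ℝ, 0 < δ₀ ∧ (∃ s : Finset (ℤ × ℤ), R.carrier = interior (⋃ p ∈ s, {z : ℂ |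
        δ₀ * (p.1 : ℝ) ≤ z.re ∧ z.re ≤ δ₀ * ((p.1 : ℝ) + 1) ∧ δ₀ * (p.2 : ℝ) ≤ z.im ∧
        z.im ≤ δ₀ * ((p.2 : ℝ) + 1)})) ∧ ∀ i, ∃ m n : ℤ, R.pt i = (δ₀ : ℂ) * ((m : ℂ) + (n : ℂ) * Complex.I)) →
      ∀ ε : ℝ, 0 < ε → ∃ ρ : ℝ, 1 < ρ ∧ ∃ δ₁ : ℝ, 0 < δ₁ ∧ ∀ t : ℝ, 1 / ρ ≤ t → t ≤ 1 →
        ∀ R' : Literature.Probability.RandomPlanarGeometry.ConformalRectangle,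
          R'.carrier = (fun z : ℂ => (t : ℂ) * z) '' R.carrier →
          R'.arc 0 = (fun z : ℂ => (t : ℂ) * z) '' R.arc 0 →
          R'.arc 2 = (fun z : ℂ => (t : ℂ) * z) '' R.arc 2 →
        ∀ δ : ℝ, 0 < δ → δ < δ₁ →
          |Literature.Probability.Percolation.bondDomainCrossingProb R' δ -
            Literature.Probability.Percolation.bondDomainCrossingProb R δ| ≤ ε := by
  intro R hR ε hε
  obtain ⟨δ₀, hδ₀, ⟨s, hs⟩, -⟩ := hR
  -- a square model of `R`
  obtain ⟨Φ, hΦ⟩ := exists_isSquareModel R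
  have hcar : R.carrier = Φ '' (Ioo (-1 : ℝ) 1 ×ℂ Ioo (-1 : ℝ) 1) := by
    rw [← hΦ.image_carrier, unitSquareQuad_carrier]
  have harc0 : R.arc 0 = Φ '' {p : ℂ | p.im = -1 ∧ p.re ∈ Icc (-1 : ℝ) 1} := by
    rw [← hΦ.image_arc 0]
    congr 1
    ext p
    exact SquareModel.mem_arc_zero
  have harc2 : R.arc 2 = Φ '' {p : ℂ | p.im = 1 ∧ p.re ∈ Icc (-1 : ℝ) 1} := by
    rw [← hΦ.image_arc 2]
    congr 1
    ext p
    exact SquareModel.mem_arc_two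
  have hΩ : Φ '' (Ioo (-1 : ℝ) 1 ×ℂ Ioo (-1 : ℝ) 1) =
      interior (⋃ p ∈ s, {z : ℂ | δ₀ * (p.1 : ℝ) ≤ z.re ∧ z.re ≤ δ₀ * ((p.1 : ℝ) + 1) ∧
        δ₀ * (p.2 : ℝ) ≤ z.im ∧ z.im ≤ δ₀ * ((p.2 : ℝ) + 1)}) := hcar ▸ hs
  -- Schramm–Smirnov's continuity of crossing events, uniformly near the quad of `R`
  set μ : Measure (BondConfig (Site 2)) := bondPercolation (zdGraph 2) half with hμ
  have hcont : ∀ (Q₀ : Quad (univ : Set ℂ)) (e : ℝ≥0∞), 0 < e →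
      ∃ Q' Q'' : Quad (univ : Set ℂ), Quad.StrictlyDominated Q' Q₀ ∧ Quad.StrictlyDominated Q₀ Q'' ∧
        ∃ δ₀ : ℝ, 0 < δ₀ ∧ ∀ δ : ℝ, 0 < δ → δ < δ₀ →
          μ {ω | (∃ K, Q'.IsCrossing K ∧ K ⊆ openEdgeUnion δ ω) ∧
            ¬ ∃ K, Q''.IsCrossing K ∧ K ⊆ openEdgeUnion δ ω} ≤ e :=
    fun Q₀ e he => Quad.continuity_of_lemma_5_1 SchrammSmirnov2011_lemma_5_1_holds Q₀ e he
  obtain ⟨δc, hδc, r, hr, H⟩ := Quad.continuity_uniform_pair hcont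
    (isCompact_singleton (x := squareModelQuad Φ)) (ENNReal.ofReal ε) (ENNReal.ofReal_pos.2 hε)
  -- a bound and two moduli of continuity of the square model on the closed square
  obtain ⟨M, hM⟩ : ∃ M, ∀ z ∈ Icc (-1 : ℝ) 1 ×ℂ Icc (-1 : ℝ) 1, ‖Φ z‖ ≤ M := by
    obtain ⟨M, hM⟩ := isBounded_iff_forall_norm_le.1 (dl_isCompact_Sq.image Φ.continuous).isBounded
    exact ⟨M, fun z hz => hM _ (mem_image_of_mem _ hz)⟩
  have hM0 : 0 ≤ M := (norm_nonneg _).trans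
    (hM 0 ⟨⟨by norm_num, by norm_num⟩, ⟨by norm_num, by norm_num⟩⟩)
  obtain ⟨η', hη'0, hη'⟩ : ∃ η' > 0, ∀ z ∈ Icc (-1 : ℝ) 1 ×ℂ Icc (-1 : ℝ) 1,
      ∀ z' ∈ Icc (-1 : ℝ) 1 ×ℂ Icc (-1 : ℝ) 1, dist z z' < η' → dist (Φ z) (Φ z') < r / 4 :=
    Metric.uniformContinuousOn_iff.1
      (dl_isCompact_Sq.uniformContinuousOn_of_continuous Φ.continuous.continuousOn) (r / 4)
      (by positivity)
  set w : ℝ := min (1 / 2) (η' / 4) with hw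
  have hw0 : 0 < w := lt_min (by norm_num) (by positivity)
  have hw12 : w ≤ 1 / 2 := min_le_left _ _
  have hwη : w < η' := by
    have := min_le_right (1 / 2 : ℝ) (η' / 4)
    linarith
  obtain ⟨sa, hsa⟩ := dl_exists_scaleHomeomorph (α := 1) (β := 1 - w) one_pos (by linarith)
  obtain ⟨sb, hsb⟩ := dl_exists_scaleHomeomorph (α := 1 - w) (β := 1) (by linarith) one_pos
  obtain ⟨η, hη0, hη⟩ : ∃ η > 0, ∀ z ∈ Φ '' (Icc (-1 : ℝ) 1 ×ℂ Icc (-1 : ℝ) 1),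
      ∀ z' ∈ Φ '' (Icc (-1 : ℝ) 1 ×ℂ Icc (-1 : ℝ) 1), dist z z' < η →
        dist (Φ.symm z) (Φ.symm z') < w / 4 :=
    Metric.uniformContinuousOn_iff.1
      ((dl_isCompact_Sq.image Φ.continuous).uniformContinuousOn_of_continuous
        Φ.symm.continuous.continuousOn) (w / 4) (by positivity)
  -- the bulk property of the discretisation of `R` on a compact box of the frame
  set K₀ : Set ℂ := Φ '' (Icc (-((1 + (1 - w)) / 2)) ((1 + (1 - w)) / 2) ×ℂ Icc (-(1 / 2 : ℝ)) (1 / 2))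
    with hK₀
  have hK₀c : IsCompact K₀ := (isCompact_Icc.reProdIm isCompact_Icc).image Φ.continuous
  have hK₀R : K₀ ⊆ R.carrier := by
    rw [hcar]
    refine image_mono fun p hp => ⟨⟨?_, ?_⟩, ⟨?_, ?_⟩⟩
    · linarith [hp.1.1]
    · linarith [hp.1.2]
    · linarith [hp.2.1]
    · linarith [hp.2.2]
  obtain ⟨δb, hδb, hbulkR⟩ := forall_mem_meshDomain_of_isCompact R K₀ hK₀c hK₀R
  have hbulk : ∀ δ' : ℝ, 0 < δ' → δ' < δb → ∀ x : Site 2, meshPoint δ' x ∈ K₀ →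
      x ∈ meshDomain (Φ '' (Ioo (-1 : ℝ) 1 ×ℂ Ioo (-1 : ℝ) 1)) δ' := fun δ' h1 h2 x hx => by
    rw [← hcar]; exact hbulkR δ' h1 h2 x hx
  -- the dilation ratio and the mesh threshold
  set ρ : ℝ := 1 + min (1 / 2) (r / (4 * (M + 1))) with hρ
  have hρmin : 0 < min (1 / 2 : ℝ) (r / (4 * (M + 1))) := lt_min (by norm_num) (by positivity)
  have hρ1 : 1 < ρ := by linarith
  have hρ32 : ρ ≤ 3 / 2 := by
    have := min_le_left (1 / 2 : ℝ) (r / (4 * (M + 1)))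
    linarith
  set δ₁ : ℝ := min (min δc (η / 16)) (min (δ₀ / 2) (δb / 2)) with hδ₁
  have hδ₁0 : 0 < δ₁ := lt_min (lt_min hδc (by positivity)) (lt_min (by positivity) (by positivity))
  refine ⟨ρ, hρ1, δ₁, hδ₁0, ?_⟩
  intro t ht1 ht2 R' hcar' harc0' harc2' δ hδ hδ1
  -- the dilation factor
  have hρ0 : 0 < ρ := by linarith
  have ht12 : 1 / 2 ≤ t := by
    have h1 : 1 / (3 / 2 : ℝ) ≤ 1 / ρ := one_div_le_one_div_of_le hρ0 hρ32
    have h2 : (1 : ℝ) / (3 / 2) = 2 / 3 := by norm_num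
    rw [h2] at h1
    linarith
  have ht0 : 0 < t := by linarith
  have ht' : (t : ℂ) ≠ 0 := by exact_mod_cast ht0.ne'
  have htM : (1 - t) * M ≤ r / 4 := by
    have h1 : 1 - t ≤ ρ - 1 := by
      have h2 : 1 - 1 / ρ ≤ ρ - 1 := by
        rw [show 1 - 1 / ρ = (ρ - 1) / ρ by field_simp]
        exact div_le_self (by linarith) hρ1.le
      linarith
    have h3 : ρ - 1 ≤ r / (4 * (M + 1)) := by
      have := min_le_right (1 / 2 : ℝ) (r / (4 * (M + 1)))
      linarith
    calc (1 - t) * M ≤ r / (4 * (M + 1)) * M := mul_le_mul_of_nonneg_right (h1.trans h3) hM0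
      _ ≤ r / (4 * (M + 1)) * (M + 1) := mul_le_mul_of_nonneg_left (by linarith) (by positivity)
      _ = r / 4 := by field_simp
  -- the mesh
  have hδc' : δ < δc := hδ1.trans_le ((min_le_left _ _).trans (min_le_left _ _))
  have hδη : 16 * δ < η := by
    have := hδ1.trans_le ((min_le_left _ _).trans (min_le_right _ _)); linarith
  have hδδ₀ : 2 * δ < δ₀ := by
    have := hδ1.trans_le ((min_le_right _ _).trans (min_le_left _ _)); linarith
  have hδb' : 2 * δ < δb := by
    have := hδ1.trans_le ((min_le_right _ _).trans (min_le_right _ _)); linarith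
  -- the sandwiches at `t` and at `1`
  obtain ⟨hlow_t, hup_t⟩ := dl_sandwich_at Φ sa sb hΩ hw0 hw12 hsa hsb hη hbulk ht12 hδ hδη hδδ₀ hδb' ht'
  have h1' : ((1 : ℝ) : ℂ) ≠ 0 := by norm_num
  obtain ⟨hlow_1, hup_1⟩ := dl_sandwich_at Φ sa sb hΩ hw0 hw12 hsa hsb hη hbulk (t := 1)
    (by norm_num) hδ hδη hδδ₀ hδb' h1'
  simp only [Complex.ofReal_one, one_mul, image_id'] at hlow_1 hup_1
  -- the four quads are within `r` of the quad of `R`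
  have hwa : |(1 : ℝ) - 1| + |1 - w - 1| < η' := by
    rw [sub_self, abs_zero, zero_add, show 1 - w - 1 = -w by ring, abs_neg, abs_of_pos hw0]; exact hwη
  have hwb : |1 - w - 1| + |(1 : ℝ) - 1| < η' := by
    rw [sub_self, abs_zero, add_zero, show 1 - w - 1 = -w by ring, abs_neg, abs_of_pos hw0]; exact hwη
  have hda_t := dl_dist_quads_lt Φ sa hsa one_pos le_rfl (by linarith) (by linarith) hr ht2 hM htM hη' hwa ht'
  have hdb_t := dl_dist_quads_lt Φ sb hsb (by linarith) (by linarith) one_pos le_rfl hr ht2 hM htM hη' hwb ht'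
  have htM1 : (1 - (1 : ℝ)) * M ≤ r / 4 := by rw [sub_self, zero_mul]; positivity
  have hda_1 := dl_dist_quads_lt Φ sa hsa one_pos le_rfl (by linarith) (by linarith) hr le_rfl hM htM1 hη' hwa h1'
  have hdb_1 := dl_dist_quads_lt Φ sb hsb (by linarith) (by linarith) one_pos le_rfl hr le_rfl hM htM1 hη' hwb h1'
  -- the continuity estimate on pairs of these quads
  have key : ∀ P' P'' : Quad (univ : Set ℂ), dist P' (squareModelQuad Φ) < r →
      dist P'' (squareModelQuad Φ) < r →
      μ.real ({ω | ∃ K, P'.IsCrossing K ∧ K ⊆ openEdgeUnion δ ω} \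
        {ω | ∃ K, P''.IsCrossing K ∧ K ⊆ openEdgeUnion δ ω}) ≤ ε := fun P' P'' h1 h2 => by
    have h := H (squareModelQuad Φ) rfl P' P'' h1 h2 δ hδ hδc'
    rw [measureReal_def]
    have h' := ENNReal.toReal_mono ENNReal.ofReal_ne_top h
    rwa [ENNReal.toReal_ofReal hε.le] at h'
  -- the two crossing probabilities
  have hP' : bondDomainCrossingProb R' δ = μ.real
      (discreteCrossing ((fun z : ℂ => (t : ℂ) * z) '' (Φ '' (Ioo (-1 : ℝ) 1 ×ℂ Ioo (-1 : ℝ) 1))) δ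
        ((fun z : ℂ => (t : ℂ) * z) '' (Φ '' {p : ℂ | p.im = -1 ∧ p.re ∈ Icc (-1 : ℝ) 1}))
        ((fun z : ℂ => (t : ℂ) * z) '' (Φ '' {p : ℂ | p.im = 1 ∧ p.re ∈ Icc (-1 : ℝ) 1}))) := by
    rw [bondDomainCrossingProb_eq_measureReal, hcar', harc0', harc2', hcar, harc0, harc2]
  have hP : bondDomainCrossingProb R δ = μ.real
      (discreteCrossing (Φ '' (Ioo (-1 : ℝ) 1 ×ℂ Ioo (-1 : ℝ) 1)) δ
        (Φ '' {p : ℂ | p.im = -1 ∧ p.re ∈ Icc (-1 : ℝ) 1})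
        (Φ '' {p : ℂ | p.im = 1 ∧ p.re ∈ Icc (-1 : ℝ) 1})) := by
    rw [bondDomainCrossingProb_eq_measureReal, hcar, harc0, harc2]
  rw [hP', hP, abs_sub_le_iff]
  exact ⟨dl_real_sub_le μ hup_t hlow_1 (key _ _ hda_t hdb_1),
    dl_real_sub_le μ hup_1 hlow_t (key _ _ hda_1 hdb_t)⟩

end Summit.CriticalPhenomena.CardyFormulaZ2.Cruxes.PolyominoGaussianLaw.Birth
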